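import Mathlib
import Summits.ValiantsHypothesis.ValiantsHypothesis.Theorems.NewtonUnitEquationsTwoProductsFormalLogLinearisationLiftedHankelChain
import Summits.ValiantsHypothesis.ValiantsHypothesis.Theorems.NewtonUnitEquationsTwoProductsFormalLogLinearisationLiftedHyperbolicCross
import HarnessLib

/-!
# Route NewtonUnitEquations — crux `TwoProducts` (stmt-ValiantsHypothesis-5906), line `formal-log-linearisation`:
# the SLOT-RANK LEMMA for cell families of pencil-visible points

Registered line `Cruxes/TwoProducts/Lines/formal-log-linearisation.lean` (NOT the item's skeleton of record; helper
mode `--supports stmt-ValiantsHypothesis-5906 --as helper`, no stub credit claimed).  Fourth file of the Hankel-rank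
tool; currency `ExpSum` of `…LiftedBox.lean` / `…LiftedHyperbolicCross.lean`.

**Idea.**  Call a set of pencil-visible points a CELL FAMILY if the weight orders of the coordinates at their
visibility parameters agree (one common total preorder `R` on `Fin s`: `R j j' ↔ u_j + t v_j ≤ u_{j'} + t v_{j'}` at
every member's `t`).  Inside a cell family, replacing a coordinate of a visible point by an `R`-lighter coordinate
(keeping its exponent) produces a lighter — hence DEAD — point.  Consequently, for visible points of one labelled shape
(support size `L`, exponents `σ_0, …, σ_{L-1}` along the increasing enumeration of the support):

* `ExpSum.slotRank_card_le` — **slot-rank lemma**: the coordinates occurring in ONE slot (with a fixed exponent `e ≥ 1`)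
  among members of a cell family number at most `|κ|` — the matrix `F(ρ_y + e·e_{d_x})` (`ρ_y` = representative of
  coordinate `d_y` with that slot zeroed) is triangular along `R` with nonzero diagonal and factors through `κ`
  (`card_le_of_triangular_factor'`);
* bookkeeping `wsum_add_single`, `prod_pow_add_single`, `expSum_add_single`, `update_add_single`.

The per-cell bound (`ExpSum.pencilCount_cell`, sequel `…LiftedCellRank.lean`) and the sweep over cells (`≤ s² + 1` of
them) then give the memo's `LiftedPencilCount` with `2^{O(log² m)}·(s² + 1)`.  Honest framing: elementary (rank + counting) for the THEORY lane of an OPEN engine;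
`stub_logSumEngine` and the crux `TwoProducts` stay OPEN, the line is not the item's skeleton of record, and nothing
here is progress on `VP ≠ VNP` (NOT proved).  No definitions, no named facts. [folklore]
-/

noncomputable section

-- Sub = Summit single-conjunct layout: the duplicated namespace component is mandated by the tree.
set_option linter.dupNamespace false

namespace Summit.ValiantsHypothesis.ValiantsHypothesis.Theorems.NewtonUnitEquations.TwoProducts.FormalLogLinearisation

open scoped BigOperators

namespace ExpSum

variable {s : ℕ}

/-- Weight of `ρ + e·e_d`: `Σ (u_i + t v_i)(ρ + e·e_d)_i = Σ (u_i + t v_i) ρ_i + e·(u_d + t v_d)`. [folklore] -/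
theorem wsum_add_single (u v : Fin s → ℝ) (t : ℝ) (ρ : Fin s → ℕ) (d : Fin s) (e : ℕ) :
    ∑ i, (u i + t * v i) * ((ρ + (Pi.single d e : Fin s → ℕ)) i : ℝ) =
      (∑ i, (u i + t * v i) * (ρ i : ℝ)) + (e : ℝ) * (u d + t * v d) := by
  classical
  simp only [Pi.add_apply, Nat.cast_add, mul_add, Finset.sum_add_distrib]
  congr 1
  rw [Finset.sum_eq_single d]
  · simp only [Pi.single_eq_same]
    ring
  · intro i _ hi; simp [hi]
  · intro h; exact absurd (Finset.mem_univ d) h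

/-- Characters at `ρ + e·e_d`: `∏ a_i^{(ρ + e·e_d)_i} = a_d^e · ∏ a_i^{ρ_i}`. [folklore] -/
theorem prod_pow_add_single (a : Fin s → ℂ) (ρ : Fin s → ℕ) (d : Fin s) (e : ℕ) :
    ∏ i, a i ^ (ρ + (Pi.single d e : Fin s → ℕ)) i = a d ^ e * ∏ i, a i ^ ρ i := by
  classical
  simp only [Pi.add_apply, pow_add, Finset.prod_mul_distrib]
  rw [mul_comm]
  congr 1
  rw [Finset.prod_eq_single d]
  · simp
  · intro i _ hi; simp [hi]
  · intro h; exact absurd (Finset.mem_univ d) h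

/-- `F(ρ + e·e_d) = Σ_k a_{kd}^e · (c_k ∏ a_{ki}^{ρ_i})` — the Hankel factorisation used by the slot-rank lemma.
[folklore] -/
theorem expSum_add_single {κ : Type*} [Fintype κ] (c : κ → ℂ) (a : κ → Fin s → ℂ) (ρ : Fin s → ℕ)
    (d : Fin s) (e : ℕ) :
    (∑ k, c k * ∏ i, a k i ^ (ρ + (Pi.single d e : Fin s → ℕ)) i) = ∑ k, a k d ^ e * (c k * ∏ i, a k i ^ ρ i) := by
  refine Finset.sum_congr rfl fun k _ => ?_
  rw [prod_pow_add_single]; ring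

/-- Zeroing a coordinate and adding it back. [folklore] -/
theorem update_add_single (μ : Fin s → ℕ) (d : Fin s) :
    Function.update μ d 0 + (Pi.single d (μ d) : Fin s → ℕ) = μ := by
  classical
  funext i
  by_cases h : i = d
  · subst h; simp
  · simp [h]

/-- **SLOT-RANK LEMMA.**  Let `F = Σ_k c_k ∏ a_{ki}^{ν_i}`, `e ≥ 1`, and let `D` be a set of coordinates such that every
`d ∈ D` has a REPRESENTATIVE `rep d` with `(rep d)_d = e`, `F(rep d) ≠ 0`, strictly `(u + τ_d v)`-minimal in
`{F ≠ 0}`, all parameters `τ_d` inducing the same weight order on the coordinates as a reference parameter `t₀`.  Then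
`#D ≤ |κ|`: sorted along that order, the matrix `(F(ρ_y + e·e_{d_x}))_{x,y}` (`ρ_y = rep d_y` with coordinate `d_y`
zeroed) vanishes above the diagonal (the point is no heavier than `rep d_y` and differs from it), is `F(rep d_y) ≠ 0`
on it, and factors through `κ`. [folklore] -/
theorem slotRank_card_le {κ : Type*} [Fintype κ] (c : κ → ℂ) (a : κ → Fin s → ℂ) (u v : Fin s → ℝ) (e : ℕ)
    (he : 1 ≤ e) (t₀ : ℝ) (D : Finset (Fin s)) (rep : Fin s → (Fin s → ℕ)) (τ : Fin s → ℝ)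
    (hrep : ∀ d ∈ D, rep d d = e ∧ (∑ k, c k * ∏ i, a k i ^ rep d i) ≠ 0 ∧
      (∀ ν : Fin s → ℕ, ν ≠ rep d → (∑ k, c k * ∏ i, a k i ^ ν i) ≠ 0 →
        ∑ i, (u i + τ d * v i) * (rep d i : ℝ) < ∑ i, (u i + τ d * v i) * (ν i : ℝ)) ∧
      (∀ j j' : Fin s, (u j + τ d * v j ≤ u j' + τ d * v j') ↔ (u j + t₀ * v j ≤ u j' + t₀ * v j'))) :
    D.card ≤ Fintype.card κ := by
  classical
  set F : (Fin s → ℕ) → ℂ := fun ν => ∑ k, c k * ∏ i, a k i ^ ν i with hF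
  -- sort `D` along the common order (ties broken by the index)
  let key : Fin s → Lex (ℝ × ℕ) := fun d => toLex (u d + t₀ * v d, (d : ℕ))
  have hkey : Set.InjOn key ↑D := by
    intro d _ d' _ h
    have h2 : ((ofLex (key d)).2) = (ofLex (key d')).2 := by rw [h]
    exact Fin.ext (by simpa [key] using h2)
  set q := D.card with hq
  have hcard : (D.image key).card = q := Finset.card_image_of_injOn hkey
  let em : Fin q ↪o Lex (ℝ × ℕ) := (D.image key).orderEmbOfFin hcard
  have hem : ∀ x : Fin q, ∃ d ∈ D, key d = em x := fun x => by
    simpa only [Finset.mem_image] using (D.image key).orderEmbOfFin_mem hcard x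
  choose f hfD hfkey using hem
  have hfinj : Function.Injective f := by
    intro x y h
    have : em x = em y := by rw [← hfkey x, ← hfkey y, h]
    exact em.injective this
  have hfle : ∀ x y : Fin q, x < y → u (f x) + t₀ * v (f x) ≤ u (f y) + t₀ * v (f y) := by
    intro x y hxy
    have hlt : key (f x) < key (f y) := by rw [hfkey, hfkey]; exact em.strictMono hxy
    exact (Prod.Lex.toLex_lt_toLex'.1 hlt).1
  -- the matrix
  let ρ : Fin q → (Fin s → ℕ) := fun y => Function.update (rep (f y)) (f y) 0
  let P : Matrix (Fin q) κ ℂ := fun x k => a k (f x) ^ e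
  let Q : Matrix κ (Fin q) ℂ := fun k y => c k * ∏ i, a k i ^ ρ y i
  have hPQ : ∀ x y, (P * Q) x y = F (ρ y + (Pi.single (f x) e : Fin s → ℕ)) := fun x y => by
    simp only [Matrix.mul_apply, P, Q, hF]
    rw [expSum_add_single]
  have hρself : ∀ y, ρ y + (Pi.single (f y) e : Fin s → ℕ) = rep (f y) := fun y => by
    have := update_add_single (rep (f y)) (f y)
    rw [(hrep (f y) (hfD y)).1] at this
    exact this
  refine card_le_of_triangular_factor' P Q (fun y => ?_) (fun x y hxy => ?_)
  · rw [hPQ, hρself]; exact (hrep (f y) (hfD y)).2.1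
  · rw [hPQ]
    obtain ⟨hdiag, hne, hvis, hord⟩ := hrep (f y) (hfD y)
    by_contra hFν
    have hνne : ρ y + (Pi.single (f x) e : Fin s → ℕ) ≠ rep (f y) := by
      intro h
      have h1 := congrFun h (f y)
      have hxy' : f x ≠ f y := fun h' => (hfinj h' ▸ hxy).false
      simp only [Pi.add_apply, ρ, Function.update_self, Pi.single_apply, hxy'.symm, if_false, add_zero] at h1
      rw [hdiag] at h1
      omega
    have hlt := hvis _ hνne hFν
    -- but the new point is no heavier than `rep (f y)` at `τ (f y)`
    have hle' : u (f x) + τ (f y) * v (f x) ≤ u (f y) + τ (f y) * v (f y) := (hord _ _).2 (hfle x y hxy)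
    have hw1 := wsum_add_single u v (τ (f y)) (ρ y) (f x) e
    have hw2 := wsum_add_single u v (τ (f y)) (ρ y) (f y) e
    rw [hρself] at hw2
    have hepos : (0 : ℝ) ≤ (e : ℝ) := by positivity
    have := mul_le_mul_of_nonneg_left hle' hepos
    linarith

end ExpSum

end Summit.ValiantsHypothesis.ValiantsHypothesis.Theorems.NewtonUnitEquations.TwoProducts.FormalLogLinearisation

end
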